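import Summits.SmoothPoincare4.SmoothPoincare4.Theorems.ConvexBisectionAcyclicBisectionExistsBeltTubeRadial
import Summits.SmoothPoincare4.SmoothPoincare4.Theorems.ConvexBisectionAcyclicBisectionExistsBeltIsotopyPush
import Summits.SmoothPoincare4.SmoothPoincare4.Theorems.ConvexBisectionAcyclicBisectionExistsBeltTubeReflect
import Literature.Topology.FourManifolds.DiffeotopyExtension
import HarnessLib

/-!
# The framed `r`-longitude of an attaching circle, VII: the tube comparison (stage (3c) of node T3c-1)
(node T3c-1 `node_belt_isotopic_pushoff` of the sub-goal T3 of stub `stub_steinRealisation` (NF6), line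
`modp-braid-orbits`, crux `ConvexBisection.AcyclicBisectionExists`, item stmt-SmoothPoincare4-10508;
wave 3, worker Z5, lead c5)

**Stage (3c).**  Let `h̄ : T → W` be a 2-handle attaching map on a compact `W`, `Φ₁ = h̄.boundaryTube` its
boundary tube, and `Φ₂` ANY second tube of `∂W` around the attaching circle (the page-adapted tube of
stage (3b) is the intended one) with the hypotheses of the uniqueness theorem
`CircleTube.exists_diffeotopy_reflect` (`hcore`, the sign `s = ±1` with `hs`, `hsgn`, and the degree-zero
condition `frameVec Φ₁ Φ₂ = rotPlane β e₀`, `β` smooth) and with SMALL target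
(`⊆ Φ₁ (𝕊¹ × B(0, 1/4))`; shrink the tube first).  Then for all small `r > 0` the `h̄`-image of the
`r`-longitude of the attaching circle, framed by the one-twist fibre framing (the end of stage (3a),
`helper_belt_slideFraming_homotopic`), is isotopic THROUGH KNOTS OF `∂W` INSIDE `h̄(T)` OFF THE CORE (so
that the isotopy can be pushed into the attached manifold) to the explicit framed knot
`θ ↦ Φ₂ (uDir b θ, reflFibre s (r θ))` with framing the velocity of
`ε ↦ Φ₂ (uDir b θ, reflFibre s (r θ) + ε reflFibre s (θ²))` — `reflFibre s w = (w₀, s w₁)`.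

*Proof.*  The reflecting diffeotopy `D` of `∂W` (`exists_diffeotopy_reflect`) extends over a collar to a
diffeotopy `G` of `W` (`BoundaryData.exists_diffeotopy_comp_incl_eq_of_compactSpace`); ONLY ITS END
`F = G₁` is used (no control of intermediate stages is needed): the isotopy is the radial isotopy from
radius `r` out to radius `1/2` (`…BeltTubeRadial.lean`) followed by the `F`-image of the radial isotopy
back in; `F` fixes the `1/2`-longitude with its framing (the target of `Φ₂` is small,
`…BeltTubeReflect.lean`), so the two pieces concatenate, and `F` carries the `r`-longitude and its fibre
framing to the explicit data in `Φ₂`-coordinates.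

* §1 the extension `F` of the end of the reflecting diffeotopy and its properties;
* §2 **`exists_tubeComparison`**; §3 registered helper `helper_belt_tubeComparison`.

Everything is proved; no named facts.

## References
* A. A. Kosinski, *Differential Manifolds*, Academic Press (1993), III (3.5), VI §6, §7 proof of (7.2).
  [Kosinski1993]
-/

noncomputable section

-- the prescribed namespace `Summit.<P>.<Sub>.…` duplicates `SmoothPoincare4` (P = Sub)
set_option linter.dupNamespace false

open scoped Manifold ContDiff Topology
open Set Function Metric Filter Bundle

namespace Summit.SmoothPoincare4.SmoothPoincare4.Theorems.AcyclicBisectionExists.ModpBraidOrbits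

open Literature.Topology.FourManifolds Literature.Topology.FourManifolds.HandleAttachingMap
  Literature.Geometry.Symplectic

variable {W : Type} [TopologicalSpace W] [T2Space W] [CompactSpace W] [ChartedSpace (EuclideanHalfSpace 4) W]
  [IsManifold (𝓡∂ 4) ∞ W]

/-! ### §1 The extended end of the reflecting diffeotopy -/

/-- **The end of the reflecting diffeotopy of `∂W`, extended over a collar to a diffeomorphism `F` of `W`**,
with its four properties: `F|∂W = D₁`; `D₁ = id` off the target of `Φ₂`;
`D₁ (Φ₁ (x, w)) = Φ₂ (x, reflFibre s w)` for `‖w‖ < r₁`; `D₁` injective.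
[cite: Kosinski1993, III (3.5) and VI §7 proof of (7.2)] -/
theorem exists_reflectExtension (f : HandleAttachingMap 3 2 W) {Φ₂ : CircleTube ↥((𝓡∂ 4).boundary W)}
    (hcore : ∀ θ, f.boundaryTube.core θ = Φ₂.core θ) {s : ℝ} (hs : s ^ 2 = 1)
    (hsgn : ∀ x, 0 < s * CircleTube.frameSign f.boundaryTube Φ₂ x)
    {β : sphere (0 : EuclideanSpace ℝ (Fin 2)) 1 → ℝ} (hβ : ContMDiff (𝓡 1) 𝓘(ℝ, ℝ) ∞ β)
    (hang : ∀ x, CircleTube.frameVec f.boundaryTube Φ₂ x = rotPlane (β x) planeE0) :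
    ∃ (F : W ≃ₘ⟮𝓡∂ 4, 𝓡∂ 4⟯ W) (D₁ : ↥((𝓡∂ 4).boundary W) → ↥((𝓡∂ 4).boundary W)) (r₁ : ℝ), 0 < r₁ ∧
      (∀ y : ↥((𝓡∂ 4).boundary W), F (y : W) = ((D₁ y : ↥((𝓡∂ 4).boundary W)) : W)) ∧
      (∀ y, y ∉ Φ₂.toHomeo.target → D₁ y = y) ∧
      (∀ (x : sphere (0 : EuclideanSpace ℝ (Fin 2)) 1) (w : EuclideanSpace ℝ (Fin 2)), ‖w‖ < r₁ →
        D₁ (f.boundaryTube.toHomeo (x, w)) = Φ₂.toHomeo (x, reflFibre s w)) ∧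
      Injective D₁ := by
  obtain ⟨D, r₁, hr₁, hDout, hD⟩ := CircleTube.exists_diffeotopy_reflect hcore hs hsgn hβ hang
  obtain ⟨G, hG⟩ := BoundaryData.exists_diffeotopy_comp_incl_eq_of_compactSpace 2
    (BoundaryManifold.boundaryData 3 W) D
  refine ⟨G.stage 1, D.toFun 1, r₁, hr₁, fun y => ?_, fun y hy => hDout 1 y hy, fun x w hw => hD x w hw, ?_⟩
  · exact congrFun (hG 1) y
  · intro a a' h
    have := congrArg (D.invFun 1) h
    rwa [D.invFun_toFun, D.invFun_toFun] at this

/-! ### §2 The tube comparison -/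

/-- **Stage (3c) — the tube comparison.**  See the module docstring. [cite: Kosinski1993, III (3.5)] -/
theorem exists_tubeComparison (f : HandleAttachingMap 3 2 W) (b : Bool) {Φ₂ : CircleTube ↥((𝓡∂ 4).boundary W)}
    (hcore : ∀ θ, f.boundaryTube.core θ = Φ₂.core θ) {s : ℝ} (hs : s ^ 2 = 1)
    (hsgn : ∀ x, 0 < s * CircleTube.frameSign f.boundaryTube Φ₂ x)
    {β : sphere (0 : EuclideanSpace ℝ (Fin 2)) 1 → ℝ} (hβ : ContMDiff (𝓡 1) 𝓘(ℝ, ℝ) ∞ β)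
    (hang : ∀ x, CircleTube.frameVec f.boundaryTube Φ₂ x = rotPlane (β x) planeE0)
    (hsmall : Φ₂.toHomeo.target ⊆ f.boundaryTube.toHomeo ''
      ((univ : Set (sphere (0 : EuclideanSpace ℝ (Fin 2)) 1)) ×ˢ ball (0 : EuclideanSpace ℝ (Fin 2)) (1 / 4))) :
    ∃ r₀ : ℝ, 0 < r₀ ∧ r₀ ≤ 1 / 4 ∧ ∀ r : ℝ, 0 < r → r < r₀ →
      ∃ (Ψ : KnotIsotopyInBoundary (fun θ => f.toFun (tubeLongitudePt b r θ))
          (fun θ => ((Φ₂.toHomeo (uDir b θ, reflFibre s (r • (θ : EuclideanSpace ℝ (Fin 2)))) :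
            ↥((𝓡∂ 4).boundary W)) : W)))
        (νt : ℝ → sphere (0 : EuclideanSpace ℝ (Fin 2)) 1 → EuclideanSpace ℝ (Fin 4)),
        (∀ t θ, Ψ.toFun t θ ∈ range f.toFun ∧ Ψ.toFun t θ ∉ f.core) ∧
        IsFramingAlong Ψ (fun θ => tubeFibreFraming f (uDir b θ) (r • (θ : EuclideanSpace ℝ (Fin 2))) (sqDir θ)) νt ∧
        ∀ θ, νt 1 θ = mfderiv 𝓘(ℝ, ℝ) (𝓡∂ 4) (fun ε : ℝ => ((Φ₂.toHomeo (uDir b θ,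
          reflFibre s (r • (θ : EuclideanSpace ℝ (Fin 2))) + ε • reflFibre s (sqDir θ)) :
            ↥((𝓡∂ 4).boundary W)) : W)) 0 (1 : ℝ) := by
  obtain ⟨F, D₁, r₁, hr₁, hF, hDout, hD, hinj⟩ := exists_reflectExtension f hcore hs hsgn hβ hang
  refine ⟨min r₁ (1 / 4), lt_min hr₁ (by norm_num), min_le_right _ _, fun r h0 hr => ?_⟩
  have hrr₁ : r < r₁ := hr.trans_le (min_le_left _ _)
  have hr4 : r < 1 / 4 := hr.trans_le (min_le_right _ _)
  have hr1 : r < 1 := by linarith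
  have hnorm : ∀ (ρ : ℝ) (_ : 0 ≤ ρ) (θ : sphere (0 : EuclideanSpace ℝ (Fin 2)) 1),
      ‖ρ • (θ : EuclideanSpace ℝ (Fin 2))‖ = ρ := fun ρ hρ θ => norm_smul_coe_sphere' hρ θ
  -- the two radial pieces and the push of the second one
  set P1 := radialIsotopy f b h0 hr1 one_half_pos one_half_lt_one with hP1
  have hP1fr := isFramingAlong_radial f b h0 hr1 one_half_pos one_half_lt_one
  set P2' := radialIsotopy f b one_half_pos one_half_lt_one h0 hr1 with hP2'
  have hP2'fr := isFramingAlong_radial f b one_half_pos one_half_lt_one h0 hr1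
  have hP2''fr := isFramingAlong_postcomp hP2'fr F
  -- the endpoints of the pushed piece
  have eStart : (⇑F ∘ fun θ : sphere (0 : EuclideanSpace ℝ (Fin 2)) 1 => f.toFun (tubeLongitudePt b (1 / 2) θ)) =
      fun θ => f.toFun (tubeLongitudePt b (1 / 2) θ) := by
    funext θ
    simp only [comp_apply]
    rw [← depthLine_uDir_smul b one_half_pos.le one_half_lt_one θ]
    exact apply_sphereTube_of_shell f hsmall F D₁ hF hDout (uDir b θ)
      (by rw [hnorm _ one_half_pos.le]; norm_num) (by rw [hnorm _ one_half_pos.le]; norm_num)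
  have eEnd : (⇑F ∘ fun θ : sphere (0 : EuclideanSpace ℝ (Fin 2)) 1 => f.toFun (tubeLongitudePt b r θ)) =
      fun θ => ((Φ₂.toHomeo (uDir b θ, reflFibre s (r • (θ : EuclideanSpace ℝ (Fin 2)))) :
        ↥((𝓡∂ 4).boundary W)) : W) := by
    funext θ
    simp only [comp_apply]
    rw [← depthLine_uDir_smul b h0.le hr1 θ]
    exact apply_sphereTube_of_lt f F D₁ hF hD (uDir b θ) (by rw [hnorm _ h0.le]; exact hrr₁)
  -- the junction framing: `dF` fixes the fibre framing of the `1/2`-longitude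
  have eν : (fun u : sphere (0 : EuclideanSpace ℝ (Fin 2)) 1 => mfderiv (𝓡∂ 4) (𝓡∂ 4) F
        ((fun θ : sphere (0 : EuclideanSpace ℝ (Fin 2)) 1 => f.toFun (tubeLongitudePt b (1 / 2) θ)) u)
        (tubeFibreFraming f (uDir b u) ((1 / 2 : ℝ) • (u : EuclideanSpace ℝ (Fin 2))) (sqDir u))) =
      fun θ => tubeFibreFraming f (uDir b θ) (radSched r (1 / 2) 1 • (θ : EuclideanSpace ℝ (Fin 2))) (sqDir θ) := by
    funext u
    rw [radSched_one]
    have key : ∀ (y : ↥(handleTube 3 2)) (_ : y = depthLine (uDir b u) ((1 / 2 : ℝ) • (u : EuclideanSpace ℝ (Fin 2))) 0),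
        mfderiv (𝓡∂ 4) (𝓡∂ 4) F (f.toFun y)
          (tubeFibreFraming f (uDir b u) ((1 / 2 : ℝ) • (u : EuclideanSpace ℝ (Fin 2))) (sqDir u)) =
        mfderiv (𝓡∂ 4) (𝓡∂ 4) F (f.toFun (depthLine (uDir b u) ((1 / 2 : ℝ) • (u : EuclideanSpace ℝ (Fin 2))) 0))
          (tubeFibreFraming f (uDir b u) ((1 / 2 : ℝ) • (u : EuclideanSpace ℝ (Fin 2))) (sqDir u)) := by
      intro y e; subst e; rfl
    show mfderiv (𝓡∂ 4) (𝓡∂ 4) F (f.toFun (tubeLongitudePt b (1 / 2) u))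
        (tubeFibreFraming f (uDir b u) ((1 / 2 : ℝ) • (u : EuclideanSpace ℝ (Fin 2))) (sqDir u)) = _
    rw [key _ (depthLine_uDir_smul b one_half_pos.le one_half_lt_one u).symm]
    exact mfderiv_apply_tubeFibreFraming_of_shell f hsmall F D₁ hF hDout (uDir b u)
      (by rw [hnorm _ one_half_pos.le]; norm_num) (by rw [hnorm _ one_half_pos.le]; norm_num) (sqDir u)
  set P2 := isotopyCast (isotopyPostcomp P2' F) eStart eEnd with hP2
  have hP2fr := isFramingAlong_cast hP2''fr eStart eEnd eν
  refine ⟨P1.trans' P2, _, fun t θ => ?_, hP1fr.trans' hP2fr, fun θ => ?_⟩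
  · -- all stages lie in `h̄(T)` off the core
    rw [KnotIsotopyInBoundary.trans'_toFun]
    split_ifs with ht
    · exact radialIsotopy_mem f b h0 hr1 one_half_pos one_half_lt_one _ θ
    · show F (f.toFun (depthLine (uDir b θ)
        (radSched (1 / 2) r (KnotIsotopyInBoundary.ρ₂ t) • (θ : EuclideanSpace ℝ (Fin 2))) 0)) ∈ range f.toFun ∧
        F (f.toFun (depthLine (uDir b θ)
          (radSched (1 / 2) r (KnotIsotopyInBoundary.ρ₂ t) • (θ : EuclideanSpace ℝ (Fin 2))) 0)) ∉ f.core
      have hρ := radSched_pos one_half_pos h0 (KnotIsotopyInBoundary.ρ₂ t)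
      have hρ' := radSched_lt_one one_half_lt_one hr1 (KnotIsotopyInBoundary.ρ₂ t)
      refine apply_sphereTube_mem f hcore hsmall F D₁ hF hDout hD hinj hr₁ (uDir b θ) ?_ (by rw [hnorm _ hρ.le]; exact hρ')
      intro h0'
      have := congrArg norm h0'
      rw [hnorm _ hρ.le, norm_zero] at this
      exact hρ.ne' this
  · -- the end framing
    show (if (1 : ℝ) ≤ 1 / 2 then (fun t θ => tubeFibreFraming f (uDir b θ)
        (radSched r (1 / 2) t • (θ : EuclideanSpace ℝ (Fin 2))) (sqDir θ)) (KnotIsotopyInBoundary.ρ₁ 1)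
      else (fun t u => mfderiv (𝓡∂ 4) (𝓡∂ 4) F (P2'.toFun t u)
        (tubeFibreFraming f (uDir b u) (radSched (1 / 2) r t • (u : EuclideanSpace ℝ (Fin 2))) (sqDir u)))
          (KnotIsotopyInBoundary.ρ₂ 1)) θ = _
    rw [if_neg (by norm_num), KnotIsotopyInBoundary.ρ₂_one]
    show mfderiv (𝓡∂ 4) (𝓡∂ 4) F (f.toFun (depthLine (uDir b θ) (radSched (1 / 2) r 1 • (θ : EuclideanSpace ℝ (Fin 2))) 0))
        (tubeFibreFraming f (uDir b θ) (radSched (1 / 2) r 1 • (θ : EuclideanSpace ℝ (Fin 2))) (sqDir θ)) = _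
    rw [radSched_one]
    exact mfderiv_apply_tubeFibreFraming_of_lt f F D₁ hF hD (uDir b θ) (by rw [hnorm _ h0.le]; exact hrr₁)
      (by rw [hnorm _ h0.le]; exact hr1) (sqDir θ)


/-! ### §3 Registered helper -/

/-- **Registered helper `helper_belt_tubeComparison` (node T3c-1 of NF6 `stub_steinRealisation`, stage (3c)
"tube comparison", wave 3, lead c5).**  For a 2-handle attaching map `h̄ : T → W` on a compact `W`, a
direction flag `b`, and ANY second tube `Φ₂` of `∂W` around the attaching circle satisfying the hypotheses
of `CircleTube.exists_diffeotopy_reflect` against `h̄.boundaryTube` (same core, sign `s = ±1` of the fibre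
derivative, degree-zero rotation field `frameVec = rotPlane β e₀`) whose target lies in
`h̄.boundaryTube (𝕊¹ × B(0, 1/4))`: there is `r₀ ∈ (0, 1/4]` such that for `0 < r < r₀` the `h̄`-image of
the `r`-longitude, framed by the one-twist fibre framing, is isotopic through knots of `∂W` lying in
`h̄(T)` off the core, the framing carried along, to `θ ↦ Φ₂ (uDir b θ, reflFibre s (r θ))` framed by the
velocity of `ε ↦ Φ₂ (uDir b θ, reflFibre s (r θ) + ε reflFibre s (θ²))` (`reflFibre s w = (w₀, s w₁)`,
`uDir b θ = (θ₀, ∓θ₁)`, `θ² = (θ₀² − θ₁², 2 θ₀ θ₁)`). [cite: Kosinski1993, III (3.5)] -/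
theorem helper_belt_tubeComparison :
    ∀ {W : Type} [TopologicalSpace W] [T2Space W] [CompactSpace W] [ChartedSpace (EuclideanHalfSpace 4) W]
      [IsManifold (𝓡∂ 4) ∞ W] (f : Literature.Topology.FourManifolds.HandleAttachingMap 3 2 W) (b : Bool)
      (Φ₂ : Literature.Topology.FourManifolds.CircleTube ↥((𝓡∂ 4).boundary W))
      (_ : ∀ θ, f.boundaryTube.core θ = Φ₂.core θ) (s : ℝ) (_ : s ^ 2 = 1)
      (_ : ∀ x, 0 < s * Literature.Topology.FourManifolds.CircleTube.frameSign f.boundaryTube Φ₂ x)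
      (β : Metric.sphere (0 : EuclideanSpace ℝ (Fin 2)) 1 → ℝ) (_ : ContMDiff (𝓡 1) 𝓘(ℝ, ℝ) ∞ β)
      (_ : ∀ x, Literature.Topology.FourManifolds.CircleTube.frameVec f.boundaryTube Φ₂ x =
        Literature.Topology.FourManifolds.rotPlane (β x) Literature.Topology.FourManifolds.planeE0)
      (_ : Φ₂.toHomeo.target ⊆ f.boundaryTube.toHomeo ''
        ((Set.univ : Set (Metric.sphere (0 : EuclideanSpace ℝ (Fin 2)) 1)) ×ˢ Metric.ball (0 : EuclideanSpace ℝ (Fin 2)) (1 / 4))),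
      ∃ r₀ : ℝ, 0 < r₀ ∧ r₀ ≤ 1 / 4 ∧ ∀ r : ℝ, 0 < r → r < r₀ →
        ∃ (Ψ : Literature.Geometry.Symplectic.KnotIsotopyInBoundary
            (fun θ => f.toFun (Summit.SmoothPoincare4.SmoothPoincare4.Theorems.AcyclicBisectionExists.ModpBraidOrbits.tubeLongitudePt b r θ))
            (fun θ => ((Φ₂.toHomeo
              (Summit.SmoothPoincare4.SmoothPoincare4.Theorems.AcyclicBisectionExists.ModpBraidOrbits.uDir b θ,
                Summit.SmoothPoincare4.SmoothPoincare4.Theorems.AcyclicBisectionExists.ModpBraidOrbits.reflFibre s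
                  (r • (θ : EuclideanSpace ℝ (Fin 2)))) : ↥((𝓡∂ 4).boundary W)) : W)))
          (νt : ℝ → Metric.sphere (0 : EuclideanSpace ℝ (Fin 2)) 1 → EuclideanSpace ℝ (Fin 4)),
          (∀ t θ, Ψ.toFun t θ ∈ Set.range f.toFun ∧ Ψ.toFun t θ ∉ f.core) ∧
          Literature.Geometry.Symplectic.IsFramingAlong Ψ
            (fun θ => mfderiv 𝓘(ℝ, ℝ) (𝓡∂ 4) (fun ε : ℝ => f.toFun (Literature.Topology.FourManifolds.depthLine
              (Summit.SmoothPoincare4.SmoothPoincare4.Theorems.AcyclicBisectionExists.ModpBraidOrbits.uDir b θ)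
              (r • (θ : EuclideanSpace ℝ (Fin 2)) +
                ε • Summit.SmoothPoincare4.SmoothPoincare4.Theorems.AcyclicBisectionExists.ModpBraidOrbits.sqDir θ) 0)) 0 (1 : ℝ))
            νt ∧
          ∀ θ, νt 1 θ = mfderiv 𝓘(ℝ, ℝ) (𝓡∂ 4) (fun ε : ℝ => ((Φ₂.toHomeo
            (Summit.SmoothPoincare4.SmoothPoincare4.Theorems.AcyclicBisectionExists.ModpBraidOrbits.uDir b θ,
              Summit.SmoothPoincare4.SmoothPoincare4.Theorems.AcyclicBisectionExists.ModpBraidOrbits.reflFibre s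
                  (r • (θ : EuclideanSpace ℝ (Fin 2))) +
                ε • Summit.SmoothPoincare4.SmoothPoincare4.Theorems.AcyclicBisectionExists.ModpBraidOrbits.reflFibre s
                  (Summit.SmoothPoincare4.SmoothPoincare4.Theorems.AcyclicBisectionExists.ModpBraidOrbits.sqDir θ)) :
                    ↥((𝓡∂ 4).boundary W)) : W)) 0 (1 : ℝ) := by
  intro W _ _ _ _ _ f b Φ₂ hcore s hs hsgn β hβ hang hsmall
  exact exists_tubeComparison f b hcore hs hsgn hβ hang hsmall

end Summit.SmoothPoincare4.SmoothPoincare4.Theorems.AcyclicBisectionExists.ModpBraidOrbits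

end
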